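/-
PORT (pub-hodgecm2, COR-CM cell) of the stage-1 package file `HodgeCMPerL/HodgeCM/Proofs/SurfaceCriterion.lean`
(pub-hodgecm HOME/lean, bytes of record md5 6b30c622149e, 41 lines). Declarations VERBATIM; edits: imports rewritten to tree
modules, namespace token `HodgeCM` ↦ `Summit.HodgeConjecture.CorCM`, package `conjRingHomK` ↦ tree `Literature.NumberTheory.Automorphic.cmConjRingHom`
(definitionally equal bodies), linter fixes. Generator: pub-hodgecm2-p1 `work/port/build_kit.py`.
-/
/-
Copyright: pub-hodgecm formalisation cell (harness21, 2026). New file (not vendored).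
-/
import Summits.HodgeConjecture.CorCM.Proofs.Prop22.Algebraic2

/-!
# rfwf Prop 2.2 `prop:weil` — the surface criterion, assembled

`Summit.HodgeConjecture.CorCM.Universe.surfaceCriterion_holds (M : U.ModelAxioms) : U.SurfaceCriterion`, from
* Steps A–D (`Summit.HodgeConjecture.CorCM.Proofs.Prop22.Dictionary.exists_weilGen_pullback`): the period data give a morphism
  `fP : S → P(f)` and an `ι₁`-Weil generator `y` with `∫_S fP^* y = ` the period;
* Step E (M26, `gysinC`): `∫_S fP^* y = ∫_{P(f)} y ∪ cl(fP_*[S])` with `cl(fP_*[S])` algebraic;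
* Step F (`Summit.HodgeConjecture.CorCM.Proofs.Prop22.Algebraic.weilLine_le_alg_of_detect`): a Weil generator pairing
  non-trivially with an algebraic class forces `W_F(P(f)) ⊆ Alg²(P(f))`.
The gen-1–3 stub `Summit.HodgeConjecture.CorCM.StubTree.prop22_surfaceCriterion` is now this theorem (`StubTree.Reduction`).
The whole Prop 2.2 sub-tree (`Summit.HodgeConjecture.CorCM/Proofs/Prop22/*`, this file) has no placeholder proofs; its only hypotheses are
the model facts `M : U.ModelAxioms` (uses M1, M2, M7, M11, M13, M18–M28; SKELETON.md §3, FACTS.md §1).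
-/

noncomputable section

namespace Summit.HodgeConjecture.CorCM

namespace Universe

variable {U : Universe}

/-- **rfwf Prop 2.2** (surface criterion) in the `Universe` model, from the model facts M1–M28. -/
theorem surfaceCriterion_holds (M : U.ModelAxioms) : U.SurfaceCriterion := by
  intro F _ f ι₁ _ S hS Fm α hα hper
  obtain ⟨fP, c, hc, htr⟩ := exists_weilGen_pullback M F f ι₁ S Fm α hα
  obtain ⟨z, hz, hgys⟩ := gysinC M S (U.prod4 F f.corner) fP hS
  have hne : U.Bc F f.corner (U.weilGen F f.corner c) z ≠ 0 := by
    rw [Bc, ← hgys, htr]; exact hper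
  exact weilLine_le_alg_of_detect M ι₁ c hc z hz hne

end Universe

end Summit.HodgeConjecture.CorCM

end
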